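import Summits.QuantumFields.BalabanUV.Beta.FP.GhostGramJets
import Summits.QuantumFields.BalabanUV.Beta.FP.InducedPolarizationCurve

/-!
# `BalabanUV.Beta.FP.GhostPairingSplit` — road «FP» (binder row D1), organisation γ, row GAMMA-9 (b) MODEL:
# **THE SCALAR PAIRING SPLIT** — the K_n-ghost's polarization is [the transported free ghost `secondVar(Δ_B; Δ̇, Δ̈)`] + [RHOA-2's induced loops
# `secondVar(Q′Δ⁻¹Q′ᵀ; Ċ, C̈)` at the SCALAR data] + [the Gram loops] − [the constraint Gram's], as a theorem about one twice-differentiable real function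

HONEST DEPENDENCY (page 1, mandatory): continuum YM on T⁴ ⇐ BetaPertH ∧ nine spine estimates (0/9 proved); BetaPertH ⇐ (D1) ∧ (D4) ∧
CAP+tail; G-an2-4 gates asym, D1 and NE2/3/4.  HONEST FRAMING (cell contract, verbatim): «discharging `BetaPertH` makes Bałaban's UV
stability UNCONDITIONAL — a real constructive-QFT result; it is NOT the continuum limit and NOT the Clay problem.»  THIS MODULE DISCHARGES
NOTHING of the wall: [folklore] block algebra + one-variable calculus over the tree's `Beta.Composition`∕`CompositionSingular` (`blockProp`, `flucCov`,
`minOp`, `flucCov_eq_constrProp`, `minOp_eq_minMap`, `det_kkt_ne_zero`), `Beta.Envelope` (`constrProp`, `minMap`), `D1BFx.LogDetSecondVariation`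
(`secondVar`, `hasDerivAt_logAbsDet`, `hasDerivAt_trace_inv_mul`), road FP's `FP.InducedPolarizationCurve` (RHOA-2: `hasDerivAt_logAbsDet_blockProp`,
`secondVariation_blockProp`) and GAMMA-9 (a)'s `FP.GhostGramSplit`∕`FP.GhostGramJets` (`ghostLogDet_sub_compression`, `hasDerivAt_minOp`,
`hasDerivAt_log_det_gram`, `hasDerivAt_gramQ`, `hasDerivAt_gramFirstVar`), all BY NAME.  No `def`, no `def … : Prop`, nothing cited, 0 sorry;
0∕4 binders of row D1; NOT hbook, NOT D1, NOT BetaPertH, NOT continuum, NOT Clay.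

ABSOLUTE RULE (cell charter, verbatim): «No internally-minted statement may enter as a cited fact. Every hypothesis is either kernel-proved
in this package or a verbatim quotation of a PUBLISHED theorem with page reference. The manuscript(s) under audit are NOT citable for their
own disputed steps — they are the thing under adjudication; programme-internal (2001/route/tribunal) claims are never citable.»

WHY (owner GAMMA-DESIGN v1.3 §11 (GH-a), route of record amended journal l.25169 to GAMMA-9 (a)'s Gram split).  With invertible `L` (the `ℤ⁴`
objects; the torus zero mode is the road's a-shift, FILE 1) and `P := blockProp L Q = Q L⁻¹ Qᵀ`, FILE 1 gives
`ghostLogDet L Q = log|det L| + log|det P| + ½·log det(𝓘ᵀ𝓘) − ½·log|det QQᵀ|` (`ghostLogDet_eq_split`).  Along the road's curve `u ↦ (Δ_{B(u)}, Q′_{B(u)})`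
this says: the K_n-ghost's coarse V-Hessian `T^{gh}_n` IS
  `secondVar(L; L̇, L̈)`            — the FULL free fine ghost one loop, transported (`= 𝓘_gᵀK^{gh}𝓘_g` + the Ad-tadpole, GAMMA-0c ✓)
`+ secondVar(P; Ċ, C̈)`            — RHOA-2's induced-polarization loop catalogue (`InducedPolarizationCurve.secondVariation_blockProp(_eq_loops)`)
                                     AT THE SCALAR DATA `(H, Q) := (Δ_B, Q′_B)`: legs `𝓘`, `𝔊_gh = P⁻¹`, `Γ₀ = constrProp = Gh`
`+ ½·secondVar(𝓘ᵀ𝓘; Ṁ, M̈)`      — the Gram loops (FILE 2)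
`− ½·secondVar(QQᵀ; …)`           — zero for unitary transports,
— the exact BOOKKEEPING of where the transported `K^{gh}` sits inside `T^{gh}`.  CAUTION (v1.1, precision E-d1leaf05g12-1): this is NOT a piece-by-piece
decomposition in the γ-END's (pp)∕(rem) currency — `secondVar(L)` carries the `|v|⁻⁶` coarse power tail of the FULL `K^{gh}` and `secondVar(P)` (legs
`P = Q′G₀Q′ᵀ`, the block-averaged FREE propagator, long-range) the opposite one; only their sum (+ Gram) is exponentially localised.  The (pp) decomposition
of record for the ghost sector is the KKT form of `FP.GhostGramJets.hasDerivAt_ghostFirstVar` (`−2`× six scalar loops, EVERY leg — `Gh`, `𝓘_gh`, `𝔊_gh` —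
exponentially localised on scale n, + Gram loops) paired with `Xtr^{gh}` inside the window through (P0)+(R1) below (`scalar_pairing_P0`, `ghost_dictionary`:
`E = Gh − G₀ = −𝓘·Q′·G₀`, n⁻²-smooth in the window by IR-4), the constraint loops and the Gram loops going to the MIX∕mass-currency engine (owner GO, journal
l.25337 (3)); (GH-a)'s counting therefore needs no new identity row.
CONTENT: §1 `ghostLogDet_eq_split`; the CHECK `firstVar_kkt_eq_split` (`tr(ΓL̇) + 2tr(𝓘Q̇) = tr(L⁻¹L̇) + tr(P⁻¹Ṗ)`: the KKT first variation of FILE 2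
§4 equals the split one); the GHOST DICTIONARY `ghost_dictionary`∕`_symm` (owner's scalar (R1): `G₀ − Gh = 𝓘·Q·G₀ = G₀·Qᵀ·𝓘ᵀ`, `𝓘 = G₀Qᵀ𝔊`, `𝔊 = P⁻¹`)
and `scalar_pairing_P0` (constrained minus free bubble∕tadpole carry one ghost remainder `E` each); §2 `hasDerivAt_ghostLogDet_split` (first variation,
split form), **`hasDerivAt_ghostFirstVar_split`** (THE PAIRING SPLIT along a curve, with `InducedPolarizationCurve.secondVariation_blockProp`'s jets
LITERALLY, so `…_eq_loops` unpacks the middle term BY NAME), `hasDerivAt_ghostFirstVar_sub_free` (the model form of «`T^{gh} − 𝓘ᵀK^{gh}𝓘`»);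
§3 **`secondVar_kkt_eq_free_add_induced`** — THE SIX KKT LOOPS = FREE FINE LOOPS + INDUCED COARSE LOOPS as an identity of 2-jets
(`secondVar (kkt L Q) 𝕂̇ 𝕂̈ = secondVar L L̇ L̈ + secondVar P Ṗ P̈`, no symmetry; Schur's `det_kkt'` differentiated twice via `secondVar_comb_eq_zero`).
NOT HERE: letters, counting, `U_n`, torus zero modes.
Unit `b2b-balaban-beta-d1-formalise-leaf-05` (gen 12), 2026-08-21; `LEAVES-FP.md` row GAMMA-9; journal INTENT 02:21:49Z; v1 = p245233 (22ae9182cf0a),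
v1.1 = module-docstring precision only (declarations byte-identical).
-/

noncomputable section

namespace Summit.QuantumFields.BalabanUV.Beta.FP.GhostPairingSplit

open Matrix Filter
open scoped Matrix BigOperators Topology
open Literature.MathematicalPhysics.QuantumFieldTheory.Balaban1983to89.Beta
open Literature.MathematicalPhysics.QuantumFieldTheory.Balaban1983to89.Beta.Composition (kkt blockProp det_kkt' det_kkt_ne_zero)
open Literature.MathematicalPhysics.QuantumFieldTheory.Balaban1983to89.Beta.CompositionSingular (flucCov minOp effForm
  flucCov_eq_constrProp minOp_eq_minMap)
open Literature.MathematicalPhysics.QuantumFieldTheory.Balaban1983to89.Beta.Envelope (constrProp minMap)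
open Literature.Analysis.Calculus (eventually_det_ne_zero)
open Summit.QuantumFields.BalabanUV.Beta.D1BFx.LogDetSecondVariation (secondVar hasDerivAt_logAbsDet hasDerivAt_trace_inv_mul secondVar_comb_eq_zero)
open Summit.QuantumFields.BalabanUV.Beta.D1BFx.SliceTransferModel (hasDerivAt_kkt)
open Summit.QuantumFields.BalabanUV.Beta.FP.GhostDeterminantModel (ghostLogDet)
open Summit.QuantumFields.BalabanUV.Beta.FP.GhostGramSplit (ghostLogDet_sub_compression det_gram_pos)
open Summit.QuantumFields.BalabanUV.Beta.FP.GhostGramJets (hasDerivAt_minOp hasDerivAt_log_det_gram hasDerivAt_gramQ hasDerivAt_gramFirstVar)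
open Summit.QuantumFields.BalabanUV.Beta.FP.InducedPolarizationCurve (hasDerivAt_logAbsDet_blockProp secondVariation_blockProp)

variable {ν μ : Type*} [Fintype ν] [Fintype μ] [DecidableEq ν] [DecidableEq μ]

/-! ## §1 The split of the K_n-ghost and the first-variation check -/

/-- [folklore] **THE SPLIT** (FILE 1's `ghostLogDet_sub_compression` rearranged, symmetric invertible `L`, invertible `P = Q L⁻¹ Qᵀ`):
`ghostLogDet L Q = log|det L| + log|det blockProp L Q| + ½·log det((minOp L Q)ᵀ·minOp L Q) − ½·log|det QQᵀ|`. -/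
theorem ghostLogDet_eq_split (L : Matrix ν ν ℝ) (Q : Matrix μ ν ℝ) (hL : IsUnit L.det) (hP : IsUnit (blockProp L Q).det) (hLs : Lᵀ = L) :
    ghostLogDet L Q = Real.log |L.det| + Real.log |(blockProp L Q).det|
      + (1 / 2 : ℝ) * Real.log ((minOp L Q)ᵀ * minOp L Q).det - (1 / 2 : ℝ) * Real.log |(Q * Qᵀ).det| := by
  have h := ghostLogDet_sub_compression L Q hL hP
  rw [hLs] at h
  linarith

/-- [folklore] **CHECK — THE TWO FIRST VARIATIONS AGREE**: for symmetric invertible `L` with invertible `P = Q L⁻¹ Qᵀ` and any jets `L₁`, `Q₁`,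
`tr(Γ·L₁) + 2·tr(𝓘·Q₁) = tr(L⁻¹·L₁) + tr(P⁻¹·(Q₁L⁻¹Qᵀ + QL⁻¹Q₁ᵀ − QL⁻¹L₁L⁻¹Qᵀ))` — FILE 2 §4's KKT form of `(ghostLogDet)′` (minus the Gram and
constraint terms, common to both) against the split form of §2 below (`Γ = L⁻¹ − L⁻¹QᵀP⁻¹QL⁻¹`, `𝓘 = L⁻¹QᵀP⁻¹`, cyclicity). -/
theorem firstVar_kkt_eq_split (L L₁ : Matrix ν ν ℝ) (Q Q₁ : Matrix μ ν ℝ) (hL : IsUnit L.det) (hP : IsUnit (blockProp L Q).det)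
    (hLs : Lᵀ = L) :
    (flucCov L Q * L₁).trace + 2 * (minOp L Q * Q₁).trace
      = (L⁻¹ * L₁).trace + ((blockProp L Q)⁻¹
          * (Q₁ * (L⁻¹ * Qᵀ) + (Q * L⁻¹) * Q₁ᵀ - (Q * L⁻¹) * L₁ * (L⁻¹ * Qᵀ))).trace := by
  have hPs : (blockProp L Q)ᵀ = blockProp L Q := by
    unfold blockProp; rw [transpose_mul, transpose_mul, transpose_transpose, transpose_nonsing_inv, hLs, Matrix.mul_assoc]
  have hLis : (L⁻¹)ᵀ = L⁻¹ := by rw [transpose_nonsing_inv, hLs]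
  have hPis : ((blockProp L Q)⁻¹)ᵀ = (blockProp L Q)⁻¹ := by rw [transpose_nonsing_inv, hPs]
  rw [flucCov_eq_constrProp L Q hL hP, minOp_eq_minMap L Q hL hP]
  unfold constrProp minMap
  simp only [Matrix.mul_add, Matrix.mul_sub, Matrix.sub_mul, trace_add, trace_sub, Matrix.mul_assoc]
  -- (e1) the first coarse term is `tr(𝓘 Q₁)`
  have e1 : ((blockProp L Q)⁻¹ * (Q₁ * (L⁻¹ * Qᵀ))).trace = (L⁻¹ * (Qᵀ * ((blockProp L Q)⁻¹ * Q₁))).trace := by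
    rw [trace_mul_cycle']
    simp only [Matrix.mul_assoc]
  -- (e2) the second coarse term is the transpose of the first
  have e2 : ((blockProp L Q)⁻¹ * (Q * (L⁻¹ * Q₁ᵀ))).trace = ((blockProp L Q)⁻¹ * (Q₁ * (L⁻¹ * Qᵀ))).trace := by
    rw [← trace_transpose]
    simp only [transpose_mul, transpose_transpose, hLis, hPis]
    rw [trace_mul_comm]
    simp only [Matrix.mul_assoc]
  -- (e3) the third coarse term is the `Γ`-correction
  have e3 : ((blockProp L Q)⁻¹ * (Q * (L⁻¹ * (L₁ * (L⁻¹ * Qᵀ))))).trace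
      = (L⁻¹ * (Qᵀ * ((blockProp L Q)⁻¹ * (Q * (L⁻¹ * L₁))))).trace := by
    have ea : Q * (L⁻¹ * (L₁ * (L⁻¹ * Qᵀ))) = (Q * (L⁻¹ * L₁)) * (L⁻¹ * Qᵀ) := by simp only [Matrix.mul_assoc]
    rw [ea, trace_mul_cycle']
    simp only [Matrix.mul_assoc]
  rw [e1, e2, e3]
  have e1' : ((blockProp L Q)⁻¹ * (Q₁ * (L⁻¹ * Qᵀ))).trace = (L⁻¹ * (Qᵀ * ((blockProp L Q)⁻¹ * Q₁))).trace := e1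
  rw [e1']
  ring

/-- [folklore] **THE GHOST DICTIONARY (scalar (R1))** — the owner's «`G₀ − Gh = G₀·Q′ᵀ·𝓘ᴸ_gh`»: for invertible `L` (`G₀ := L⁻¹`) with invertible
`P = Q L⁻¹ Qᵀ`: (i) `L⁻¹ − flucCov L Q = minOp L Q · Q · L⁻¹` (the ghost remainder `E := Gh − G₀ = −𝓘·Q·G₀` factors through the CONSTRAINT leg `Q·G₀`
and the minimiser), (ii) `minOp L Q = L⁻¹·Qᵀ·effForm L Q` (`𝓘 = G₀Q′ᵀ𝔊_gh`), (iii) `effForm L Q = P⁻¹`. -/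
theorem ghost_dictionary (L : Matrix ν ν ℝ) (Q : Matrix μ ν ℝ) (hL : IsUnit L.det) (hP : IsUnit (blockProp L Q).det) :
    L⁻¹ - flucCov L Q = minOp L Q * Q * L⁻¹ ∧ minOp L Q = L⁻¹ * Qᵀ * effForm L Q ∧ effForm L Q = (blockProp L Q)⁻¹ := by
  have hm := minOp_eq_minMap L Q hL hP
  have he := CompositionSingular.effForm_eq_blockProp_inv L Q hL hP
  refine ⟨?_, by rw [hm, he], he⟩
  rw [flucCov_eq_constrProp L Q hL hP, hm]
  unfold constrProp minMap
  rw [sub_sub_cancel]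

/-- [folklore] The symmetric reading of (i): `L⁻¹ − flucCov L Q = L⁻¹·Qᵀ·(minOp L Q)ᵀ` (`Lᵀ = L`; `E = −G₀·Q′ᵀ·𝓘ᵀ`). -/
theorem ghost_dictionary_symm (L : Matrix ν ν ℝ) (Q : Matrix μ ν ℝ) (hL : IsUnit L.det) (hP : IsUnit (blockProp L Q).det)
    (hLs : Lᵀ = L) : L⁻¹ - flucCov L Q = L⁻¹ * Qᵀ * (minOp L Q)ᵀ := by
  have h1 := (ghost_dictionary L Q hL hP).1
  have hΓ : (flucCov L Q)ᵀ = flucCov L Q := (CompositionSingular.minOpL_eq_transpose L Q hLs).2.1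
  have hLi : (L⁻¹)ᵀ = L⁻¹ := by rw [transpose_nonsing_inv, hLs]
  have h2 := congrArg Matrix.transpose h1
  rw [transpose_sub, hLi, hΓ, transpose_mul, transpose_mul, hLi, ← Matrix.mul_assoc] at h2
  exact h2

/-- [folklore] **THE SCALAR (P0) PAIRING**: with `E := flucCov L Q − L⁻¹` (the ghost remainder, (i) above), the constrained bubble and tadpole minus the free
ones are `tr(ΓL₁ΓL₁) − tr(G₀L₁G₀L₁) = tr(EL₁ΓL₁) + tr(G₀L₁EL₁)` and `tr(ΓL₂) − tr(G₀L₂) = tr(EL₂)` — each term carries one `E`. -/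
theorem scalar_pairing_P0 (L L₁ L₂ : Matrix ν ν ℝ) (Q : Matrix μ ν ℝ) :
    (flucCov L Q * L₁ * (flucCov L Q * L₁)).trace - (L⁻¹ * L₁ * (L⁻¹ * L₁)).trace
        = ((flucCov L Q - L⁻¹) * L₁ * (flucCov L Q * L₁)).trace + (L⁻¹ * L₁ * ((flucCov L Q - L⁻¹) * L₁)).trace
      ∧ (flucCov L Q * L₂).trace - (L⁻¹ * L₂).trace = ((flucCov L Q - L⁻¹) * L₂).trace := by
  constructor
  · simp only [Matrix.sub_mul, Matrix.mul_sub, trace_sub]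
    ring
  · rw [Matrix.sub_mul, trace_sub]

/-! ## §2 The split along a curve: first variation and THE PAIRING SPLIT -/

/-- [folklore] **FIRST VARIATION, SPLIT FORM**: along curves `u ↦ L u` (symmetric, invertible near `t`), `u ↦ Q u` (block propagator invertible
near `t`, constraint Gram invertible at `t`) with derivatives `L₁`, `Q₁` at `t`:
`(ghostLogDet (L u) (Q u))′(t) = tr(L⁻¹L₁) + tr(P⁻¹·Ṗ) + ½·tr((𝓘ᵀ𝓘)⁻¹(𝓘̇ᵀ𝓘 + 𝓘ᵀ𝓘̇)) − ½·tr((QQᵀ)⁻¹(Q₁Qᵀ + QQ₁ᵀ))`,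
`Ṗ = Q₁L⁻¹Qᵀ + QL⁻¹Q₁ᵀ − QL⁻¹L₁L⁻¹Qᵀ` (RHOA-2's first jet), `𝓘̇ = −(ΓL₁𝓘 + 𝓘Q₁𝓘 − ΓQ₁ᵀ𝔊)` (FILE 2). -/
theorem hasDerivAt_ghostLogDet_split {L : ℝ → ν → ν → ℝ} {Q : ℝ → μ → ν → ℝ} {L₁ : Matrix ν ν ℝ} {Q₁ : Matrix μ ν ℝ} {t : ℝ}
    (hL : HasDerivAt L (Matrix.of.symm L₁) t) (hQ : HasDerivAt Q (Matrix.of.symm Q₁) t)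
    (hsym : ∀ᶠ u in 𝓝 t, (Matrix.of (L u))ᵀ = Matrix.of (L u)) (hdetL : ∀ᶠ u in 𝓝 t, (Matrix.of (L u)).det ≠ 0)
    (hP : ∀ᶠ u in 𝓝 t, (blockProp (Matrix.of (L u)) (Matrix.of (Q u))).det ≠ 0) (hG : (Matrix.of (Q t) * (Matrix.of (Q t))ᵀ).det ≠ 0) :
    HasDerivAt (fun u => ghostLogDet (Matrix.of (L u)) (Matrix.of (Q u)))
      (((Matrix.of (L t))⁻¹ * L₁).trace
        + (((blockProp (Matrix.of (L t)) (Matrix.of (Q t)))⁻¹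
            * (Q₁ * ((Matrix.of (L t))⁻¹ * (Matrix.of (Q t))ᵀ) + (Matrix.of (Q t) * (Matrix.of (L t))⁻¹) * Q₁ᵀ
                - (Matrix.of (Q t) * (Matrix.of (L t))⁻¹) * L₁ * ((Matrix.of (L t))⁻¹ * (Matrix.of (Q t))ᵀ))).trace)
        + (1 / 2 : ℝ) * ((((minOp (Matrix.of (L t)) (Matrix.of (Q t)))ᵀ * minOp (Matrix.of (L t)) (Matrix.of (Q t)))⁻¹
            * ((-(flucCov (Matrix.of (L t)) (Matrix.of (Q t)) * L₁ * minOp (Matrix.of (L t)) (Matrix.of (Q t))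
                  + minOp (Matrix.of (L t)) (Matrix.of (Q t)) * Q₁ * minOp (Matrix.of (L t)) (Matrix.of (Q t))
                  - flucCov (Matrix.of (L t)) (Matrix.of (Q t)) * Q₁ᵀ * effForm (Matrix.of (L t)) (Matrix.of (Q t))))ᵀ
                * minOp (Matrix.of (L t)) (Matrix.of (Q t))
              + (minOp (Matrix.of (L t)) (Matrix.of (Q t)))ᵀ
                * -(flucCov (Matrix.of (L t)) (Matrix.of (Q t)) * L₁ * minOp (Matrix.of (L t)) (Matrix.of (Q t))
                  + minOp (Matrix.of (L t)) (Matrix.of (Q t)) * Q₁ * minOp (Matrix.of (L t)) (Matrix.of (Q t))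
                  - flucCov (Matrix.of (L t)) (Matrix.of (Q t)) * Q₁ᵀ * effForm (Matrix.of (L t)) (Matrix.of (Q t))))).trace)
        - (1 / 2 : ℝ) * (((Matrix.of (Q t) * (Matrix.of (Q t))ᵀ)⁻¹ * (Q₁ * (Matrix.of (Q t))ᵀ + Matrix.of (Q t) * Q₁ᵀ)).trace)) t := by
  have hkkt : ∀ᶠ u in 𝓝 t, (kkt (Matrix.of (L u)) (Matrix.of (Q u))).det ≠ 0 := by
    filter_upwards [hdetL, hP] with u hu huP
    exact det_kkt_ne_zero _ _ (isUnit_iff_ne_zero.2 hu) (isUnit_iff_ne_zero.2 huP)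
  have h1 := hasDerivAt_logAbsDet (A := L) (A₁ := L₁) hL hdetL.self_of_nhds
  have h2 := hasDerivAt_logAbsDet_blockProp hL hQ hdetL.self_of_nhds hP.self_of_nhds
  have h3 := hasDerivAt_log_det_gram (hasDerivAt_minOp hL hQ hsym.self_of_nhds hkkt.self_of_nhds) hkkt
  have h4 : HasDerivAt (fun u => Real.log |(Matrix.of (Q u) * (Matrix.of (Q u))ᵀ).det|)
      (((Matrix.of (Q t) * (Matrix.of (Q t))ᵀ)⁻¹ * (Q₁ * (Matrix.of (Q t))ᵀ + Matrix.of (Q t) * Q₁ᵀ)).trace) t :=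
    hasDerivAt_logAbsDet (A := fun u => Matrix.of.symm (Matrix.of (Q u) * (Matrix.of (Q u))ᵀ))
      (A₁ := Q₁ * (Matrix.of (Q t))ᵀ + Matrix.of (Q t) * Q₁ᵀ) (hasDerivAt_gramQ hQ) hG
  have hsum := ((h1.add h2).add (h3.const_mul (1 / 2 : ℝ))).sub (h4.const_mul (1 / 2 : ℝ))
  have heq : ∀ᶠ u in 𝓝 t, ghostLogDet (Matrix.of (L u)) (Matrix.of (Q u)) =
      Real.log |(Matrix.of (L u)).det| + Real.log |(blockProp (Matrix.of (L u)) (Matrix.of (Q u))).det|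
        + (1 / 2 : ℝ) * Real.log ((minOp (Matrix.of (L u)) (Matrix.of (Q u)))ᵀ * minOp (Matrix.of (L u)) (Matrix.of (Q u))).det
        - (1 / 2 : ℝ) * Real.log |(Matrix.of (Q u) * (Matrix.of (Q u))ᵀ).det| := by
    filter_upwards [hsym, hdetL, hP] with u hus hu huP
    exact ghostLogDet_eq_split _ _ (isUnit_iff_ne_zero.2 hu) (isUnit_iff_ne_zero.2 huP) hus
  exact (hsum.congr_of_eventuallyEq heq).congr_deriv (by ring)

/-- [folklore] **THE PAIRING SPLIT (second variation of the K_n-ghost, split form).**  Data: `C²` curves `L` (invertible near `t`), `Q` with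
first-jet curves `L₁`, `Q₁` near `t` and second jets `L₂`, `Q₂` at `t`; the block propagator and the constraint Gram invertible at `t`, the bordered
matrix invertible at `t`; the minimiser's jet curve `I₁` near `t` with derivative `I₂` at `t` (FILE 2 `hasDerivAt_minOp_eventually`); the constraint
Gram's jet curve `C₁` with derivative `C₂`.  Then the split first-variation density
`g u := tr(L⁻¹L₁) + tr(P⁻¹Ṗ) + ½·tr((𝓘ᵀ𝓘)⁻¹(I₁ᵀ𝓘 + 𝓘ᵀI₁)) − ½·tr((QQᵀ)⁻¹C₁)` has derivative at `t`
`secondVar L L₁ L₂ + secondVar P Ṗ P̈ + ½·secondVar (𝓘ᵀ𝓘) Ṁ M̈ − ½·secondVar (QQᵀ) C₁ C₂`,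
with `Ṗ, P̈` LITERALLY the jets of `InducedPolarizationCurve.secondVariation_blockProp` (so `secondVariation_blockProp_eq_loops` unpacks the second
term into RHOA-2's loop catalogue BY NAME) — [free fine ghost] + [induced coarse loops at scalar data] + [Gram loops] − [constraint Gram]. -/
theorem hasDerivAt_ghostFirstVar_split {L L₁ : ℝ → ν → ν → ℝ} {L₂ : Matrix ν ν ℝ} {Q Q₁ : ℝ → μ → ν → ℝ} {Q₂ : Matrix μ ν ℝ}
    {I₁ : ℝ → ν → μ → ℝ} {I₂ : Matrix ν μ ℝ} {C₁ : ℝ → μ → μ → ℝ} {C₂ : Matrix μ μ ℝ} {t : ℝ}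
    (hL : ∀ᶠ u in 𝓝 t, HasDerivAt L (L₁ u) u) (hQ : ∀ᶠ u in 𝓝 t, HasDerivAt Q (Q₁ u) u)
    (hL₁ : HasDerivAt L₁ (Matrix.of.symm L₂) t) (hQ₁ : HasDerivAt Q₁ (Matrix.of.symm Q₂) t)
    (hI : ∀ᶠ u in 𝓝 t, HasDerivAt (fun u => Matrix.of.symm (minOp (Matrix.of (L u)) (Matrix.of (Q u)))) (I₁ u) u)
    (hI₁ : HasDerivAt I₁ (Matrix.of.symm I₂) t)
    (hC : HasDerivAt (fun u => Matrix.of.symm (Matrix.of (Q u) * (Matrix.of (Q u))ᵀ)) (C₁ t) t) (hC₁ : HasDerivAt C₁ (Matrix.of.symm C₂) t)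
    (hdetL : ∀ᶠ u in 𝓝 t, (Matrix.of (L u)).det ≠ 0) (hP : (blockProp (Matrix.of (L t)) (Matrix.of (Q t))).det ≠ 0)
    (hG : (Matrix.of (Q t) * (Matrix.of (Q t))ᵀ).det ≠ 0) :
    HasDerivAt (fun u => ((Matrix.of (L u))⁻¹ * Matrix.of (L₁ u)).trace
        + ((blockProp (Matrix.of (L u)) (Matrix.of (Q u)))⁻¹
          * (Matrix.of (Q₁ u) * (Matrix.of (L u))⁻¹ * (Matrix.of (Q u))ᵀ + Matrix.of (Q u) * (Matrix.of (L u))⁻¹ * (Matrix.of (Q₁ u))ᵀ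
              - Matrix.of (Q u) * (Matrix.of (L u))⁻¹ * Matrix.of (L₁ u) * (Matrix.of (L u))⁻¹ * (Matrix.of (Q u))ᵀ)).trace
        + (1 / 2 : ℝ) * ((((minOp (Matrix.of (L u)) (Matrix.of (Q u)))ᵀ * minOp (Matrix.of (L u)) (Matrix.of (Q u)))⁻¹
          * ((Matrix.of (I₁ u))ᵀ * minOp (Matrix.of (L u)) (Matrix.of (Q u)) + (minOp (Matrix.of (L u)) (Matrix.of (Q u)))ᵀ * Matrix.of (I₁ u))).trace)
        - (1 / 2 : ℝ) * (((Matrix.of (Q u) * (Matrix.of (Q u))ᵀ)⁻¹ * Matrix.of (C₁ u)).trace))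
      (secondVar (Matrix.of (L t)) (Matrix.of (L₁ t)) L₂
        + secondVar (blockProp (Matrix.of (L t)) (Matrix.of (Q t)))
            (Matrix.of (Q₁ t) * (Matrix.of (L t))⁻¹ * (Matrix.of (Q t))ᵀ + Matrix.of (Q t) * (Matrix.of (L t))⁻¹ * (Matrix.of (Q₁ t))ᵀ
                - Matrix.of (Q t) * (Matrix.of (L t))⁻¹ * Matrix.of (L₁ t) * (Matrix.of (L t))⁻¹ * (Matrix.of (Q t))ᵀ)
            (Q₂ * ((Matrix.of (L t))⁻¹ * (Matrix.of (Q t))ᵀ) + (Matrix.of (Q t) * (Matrix.of (L t))⁻¹) * Q₂ᵀ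
              - (2 : ℝ) • (Matrix.of (Q₁ t) * (Matrix.of (L t))⁻¹ * Matrix.of (L₁ t) * ((Matrix.of (L t))⁻¹ * (Matrix.of (Q t))ᵀ))
              - (2 : ℝ) • ((Matrix.of (Q t) * (Matrix.of (L t))⁻¹) * Matrix.of (L₁ t) * (Matrix.of (L t))⁻¹ * (Matrix.of (Q₁ t))ᵀ)
              + (2 : ℝ) • (Matrix.of (Q₁ t) * (Matrix.of (L t))⁻¹ * (Matrix.of (Q₁ t))ᵀ)
              + (2 : ℝ) • ((Matrix.of (Q t) * (Matrix.of (L t))⁻¹) * Matrix.of (L₁ t) * (Matrix.of (L t))⁻¹ * Matrix.of (L₁ t)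
                  * ((Matrix.of (L t))⁻¹ * (Matrix.of (Q t))ᵀ))
              - (Matrix.of (Q t) * (Matrix.of (L t))⁻¹) * L₂ * ((Matrix.of (L t))⁻¹ * (Matrix.of (Q t))ᵀ))
        + (1 / 2 : ℝ) * secondVar ((minOp (Matrix.of (L t)) (Matrix.of (Q t)))ᵀ * minOp (Matrix.of (L t)) (Matrix.of (Q t)))
            ((Matrix.of (I₁ t))ᵀ * minOp (Matrix.of (L t)) (Matrix.of (Q t)) + (minOp (Matrix.of (L t)) (Matrix.of (Q t)))ᵀ * Matrix.of (I₁ t))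
            (I₂ᵀ * minOp (Matrix.of (L t)) (Matrix.of (Q t)) + (Matrix.of (I₁ t))ᵀ * Matrix.of (I₁ t)
              + ((Matrix.of (I₁ t))ᵀ * Matrix.of (I₁ t) + (minOp (Matrix.of (L t)) (Matrix.of (Q t)))ᵀ * I₂))
        - (1 / 2 : ℝ) * secondVar (Matrix.of (Q t) * (Matrix.of (Q t))ᵀ) (Matrix.of (C₁ t)) C₂) t := by
  have hkkt : (kkt (Matrix.of (L t)) (Matrix.of (Q t))).det ≠ 0 :=
    det_kkt_ne_zero _ _ (isUnit_iff_ne_zero.2 hdetL.self_of_nhds) (isUnit_iff_ne_zero.2 hP)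
  have h1 : HasDerivAt (fun u => ((Matrix.of (L u))⁻¹ * Matrix.of (L₁ u)).trace) (secondVar (Matrix.of (L t)) (Matrix.of (L₁ t)) L₂) t :=
    hasDerivAt_trace_inv_mul (A := L) (A₁ := L₁) hL.self_of_nhds hL₁ hdetL.self_of_nhds
  have h2 := secondVariation_blockProp hL hQ hL₁ hQ₁ hdetL hP
  have h3 := hasDerivAt_gramFirstVar hI hI₁ hkkt
  have h4 : HasDerivAt (fun u => ((Matrix.of (Q u) * (Matrix.of (Q u))ᵀ)⁻¹ * Matrix.of (C₁ u)).trace)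
      (secondVar (Matrix.of (Q t) * (Matrix.of (Q t))ᵀ) (Matrix.of (C₁ t)) C₂) t :=
    hasDerivAt_trace_inv_mul (A := fun u => Matrix.of.symm (Matrix.of (Q u) * (Matrix.of (Q u))ᵀ)) hC hC₁ hG
  exact ((h1.add h2).add (h3.const_mul (1 / 2 : ℝ))).sub (h4.const_mul (1 / 2 : ℝ))

/-- [folklore] **THE MODEL FORM OF «`T^{gh} − 𝓘ᵀK^{gh}𝓘`»**: subtracting the free fine ghost's density `tr(L⁻¹L₁)` (whose derivative `secondVar L L₁ L₂` is,
on the road, the transported FULL `K^{gh}` plus the vanishing Ad-tadpole) from the split density leaves a function whose derivative at `t` is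
`secondVar P Ṗ P̈ + ½·secondVar (𝓘ᵀ𝓘) Ṁ M̈ − ½·secondVar (QQᵀ) C₁ C₂` — induced coarse loops at scalar data + Gram loops − constraint Gram:
every leg is one of `P⁻¹ = 𝔊_gh`, `L⁻¹Qᵀ`-columns (`𝓘·P`), `𝓘`, `Γ`, `(𝓘ᵀ𝓘)⁻¹`, `(QQᵀ)⁻¹`. -/
theorem hasDerivAt_ghostFirstVar_sub_free {L L₁ : ℝ → ν → ν → ℝ} {L₂ : Matrix ν ν ℝ} {Q Q₁ : ℝ → μ → ν → ℝ} {Q₂ : Matrix μ ν ℝ}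
    {I₁ : ℝ → ν → μ → ℝ} {I₂ : Matrix ν μ ℝ} {C₁ : ℝ → μ → μ → ℝ} {C₂ : Matrix μ μ ℝ} {t : ℝ}
    (hL : ∀ᶠ u in 𝓝 t, HasDerivAt L (L₁ u) u) (hQ : ∀ᶠ u in 𝓝 t, HasDerivAt Q (Q₁ u) u)
    (hL₁ : HasDerivAt L₁ (Matrix.of.symm L₂) t) (hQ₁ : HasDerivAt Q₁ (Matrix.of.symm Q₂) t)
    (hI : ∀ᶠ u in 𝓝 t, HasDerivAt (fun u => Matrix.of.symm (minOp (Matrix.of (L u)) (Matrix.of (Q u)))) (I₁ u) u)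
    (hI₁ : HasDerivAt I₁ (Matrix.of.symm I₂) t)
    (hC : HasDerivAt (fun u => Matrix.of.symm (Matrix.of (Q u) * (Matrix.of (Q u))ᵀ)) (C₁ t) t) (hC₁ : HasDerivAt C₁ (Matrix.of.symm C₂) t)
    (hdetL : ∀ᶠ u in 𝓝 t, (Matrix.of (L u)).det ≠ 0) (hP : (blockProp (Matrix.of (L t)) (Matrix.of (Q t))).det ≠ 0)
    (hG : (Matrix.of (Q t) * (Matrix.of (Q t))ᵀ).det ≠ 0) :
    HasDerivAt (fun u => ((blockProp (Matrix.of (L u)) (Matrix.of (Q u)))⁻¹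
          * (Matrix.of (Q₁ u) * (Matrix.of (L u))⁻¹ * (Matrix.of (Q u))ᵀ + Matrix.of (Q u) * (Matrix.of (L u))⁻¹ * (Matrix.of (Q₁ u))ᵀ
              - Matrix.of (Q u) * (Matrix.of (L u))⁻¹ * Matrix.of (L₁ u) * (Matrix.of (L u))⁻¹ * (Matrix.of (Q u))ᵀ)).trace
        + (1 / 2 : ℝ) * ((((minOp (Matrix.of (L u)) (Matrix.of (Q u)))ᵀ * minOp (Matrix.of (L u)) (Matrix.of (Q u)))⁻¹
          * ((Matrix.of (I₁ u))ᵀ * minOp (Matrix.of (L u)) (Matrix.of (Q u)) + (minOp (Matrix.of (L u)) (Matrix.of (Q u)))ᵀ * Matrix.of (I₁ u))).trace)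
        - (1 / 2 : ℝ) * (((Matrix.of (Q u) * (Matrix.of (Q u))ᵀ)⁻¹ * Matrix.of (C₁ u)).trace))
      (secondVar (blockProp (Matrix.of (L t)) (Matrix.of (Q t)))
            (Matrix.of (Q₁ t) * (Matrix.of (L t))⁻¹ * (Matrix.of (Q t))ᵀ + Matrix.of (Q t) * (Matrix.of (L t))⁻¹ * (Matrix.of (Q₁ t))ᵀ
                - Matrix.of (Q t) * (Matrix.of (L t))⁻¹ * Matrix.of (L₁ t) * (Matrix.of (L t))⁻¹ * (Matrix.of (Q t))ᵀ)
            (Q₂ * ((Matrix.of (L t))⁻¹ * (Matrix.of (Q t))ᵀ) + (Matrix.of (Q t) * (Matrix.of (L t))⁻¹) * Q₂ᵀ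
              - (2 : ℝ) • (Matrix.of (Q₁ t) * (Matrix.of (L t))⁻¹ * Matrix.of (L₁ t) * ((Matrix.of (L t))⁻¹ * (Matrix.of (Q t))ᵀ))
              - (2 : ℝ) • ((Matrix.of (Q t) * (Matrix.of (L t))⁻¹) * Matrix.of (L₁ t) * (Matrix.of (L t))⁻¹ * (Matrix.of (Q₁ t))ᵀ)
              + (2 : ℝ) • (Matrix.of (Q₁ t) * (Matrix.of (L t))⁻¹ * (Matrix.of (Q₁ t))ᵀ)
              + (2 : ℝ) • ((Matrix.of (Q t) * (Matrix.of (L t))⁻¹) * Matrix.of (L₁ t) * (Matrix.of (L t))⁻¹ * Matrix.of (L₁ t)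
                  * ((Matrix.of (L t))⁻¹ * (Matrix.of (Q t))ᵀ))
              - (Matrix.of (Q t) * (Matrix.of (L t))⁻¹) * L₂ * ((Matrix.of (L t))⁻¹ * (Matrix.of (Q t))ᵀ))
        + (1 / 2 : ℝ) * secondVar ((minOp (Matrix.of (L t)) (Matrix.of (Q t)))ᵀ * minOp (Matrix.of (L t)) (Matrix.of (Q t)))
            ((Matrix.of (I₁ t))ᵀ * minOp (Matrix.of (L t)) (Matrix.of (Q t)) + (minOp (Matrix.of (L t)) (Matrix.of (Q t)))ᵀ * Matrix.of (I₁ t))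
            (I₂ᵀ * minOp (Matrix.of (L t)) (Matrix.of (Q t)) + (Matrix.of (I₁ t))ᵀ * Matrix.of (I₁ t)
              + ((Matrix.of (I₁ t))ᵀ * Matrix.of (I₁ t) + (minOp (Matrix.of (L t)) (Matrix.of (Q t)))ᵀ * I₂))
        - (1 / 2 : ℝ) * secondVar (Matrix.of (Q t) * (Matrix.of (Q t))ᵀ) (Matrix.of (C₁ t)) C₂) t := by
  have hkkt : (kkt (Matrix.of (L t)) (Matrix.of (Q t))).det ≠ 0 :=
    det_kkt_ne_zero _ _ (isUnit_iff_ne_zero.2 hdetL.self_of_nhds) (isUnit_iff_ne_zero.2 hP)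
  have h2 := secondVariation_blockProp hL hQ hL₁ hQ₁ hdetL hP
  have h3 := hasDerivAt_gramFirstVar hI hI₁ hkkt
  have h4 : HasDerivAt (fun u => ((Matrix.of (Q u) * (Matrix.of (Q u))ᵀ)⁻¹ * Matrix.of (C₁ u)).trace)
      (secondVar (Matrix.of (Q t) * (Matrix.of (Q t))ᵀ) (Matrix.of (C₁ t)) C₂) t :=
    hasDerivAt_trace_inv_mul (A := fun u => Matrix.of.symm (Matrix.of (Q u) * (Matrix.of (Q u))ᵀ)) hC hC₁ hG
  exact (h2.add (h3.const_mul (1 / 2 : ℝ))).sub (h4.const_mul (1 / 2 : ℝ))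

/-! ## §3 THE SIX LOOPS SPLIT: `secondVar 𝕂 = secondVar L + secondVar P` (free fine loops + RHOA-2's induced coarse loops) -/

/-- [folklore] **THE SIX KKT LOOPS ARE THE FREE FINE LOOPS PLUS THE INDUCED COARSE LOOPS.**  For `C²` curves `L` (invertible at `t`), `Q` (block
propagator invertible at `t`) with first-jet curves `L₁`, `Q₁` near `t` and second jets `L₂`, `Q₂` at `t` — NO symmetry needed:
`secondVar (kkt L Q) (kkt L₁ Q₁) (kkt L₂ Q₂) = secondVar L L₁ L₂ + secondVar (Q L⁻¹ Qᵀ) Ṗ P̈` at `t`, with `Ṗ, P̈` the displayed jets of the block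
propagator (`InducedPolarizationCurve.hasDerivAt_blockProp(_jet₁)`), i.e. `−2·[six loops] = [tr(L⁻¹L̈) − tr(L⁻¹L̇L⁻¹L̇)] + [RHOA-2's catalogue]` — Schur's
`det kkt(L,Q) = (−1)^{|μ|}·det L·det(QL⁻¹Qᵀ)` (`Composition.det_kkt'`) differentiated twice (`LogDetSecondVariation.secondVar_comb_eq_zero`).  On road FP
with the scalar data `(L, Q) := (Δ_B, Q′_B)` the left side is `−2`× the K_n-ghost's six loops, the first summand is the transported FULL `K^{gh}` (+ the
Ad-tadpole), the second is the induced coarse ghost's loops: THE SCALAR PAIRING needs no further identity. -/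
theorem secondVar_kkt_eq_free_add_induced {L L₁ : ℝ → ν → ν → ℝ} {L₂ : Matrix ν ν ℝ} {Q Q₁ : ℝ → μ → ν → ℝ} {Q₂ : Matrix μ ν ℝ} {t : ℝ}
    (hL : ∀ᶠ u in 𝓝 t, HasDerivAt L (L₁ u) u) (hQ : ∀ᶠ u in 𝓝 t, HasDerivAt Q (Q₁ u) u)
    (hL₁ : HasDerivAt L₁ (Matrix.of.symm L₂) t) (hQ₁ : HasDerivAt Q₁ (Matrix.of.symm Q₂) t)
    (hdetL : (Matrix.of (L t)).det ≠ 0) (hP : (blockProp (Matrix.of (L t)) (Matrix.of (Q t))).det ≠ 0) :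
    secondVar (kkt (Matrix.of (L t)) (Matrix.of (Q t))) (kkt (Matrix.of (L₁ t)) (Matrix.of (Q₁ t))) (kkt L₂ Q₂)
      = secondVar (Matrix.of (L t)) (Matrix.of (L₁ t)) L₂
        + secondVar (blockProp (Matrix.of (L t)) (Matrix.of (Q t)))
            (Matrix.of (Q₁ t) * (Matrix.of (L t))⁻¹ * (Matrix.of (Q t))ᵀ + Matrix.of (Q t) * (Matrix.of (L t))⁻¹ * (Matrix.of (Q₁ t))ᵀ
                - Matrix.of (Q t) * (Matrix.of (L t))⁻¹ * Matrix.of (L₁ t) * (Matrix.of (L t))⁻¹ * (Matrix.of (Q t))ᵀ)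
            (Q₂ * ((Matrix.of (L t))⁻¹ * (Matrix.of (Q t))ᵀ) + (Matrix.of (Q t) * (Matrix.of (L t))⁻¹) * Q₂ᵀ
              - (2 : ℝ) • (Matrix.of (Q₁ t) * (Matrix.of (L t))⁻¹ * Matrix.of (L₁ t) * ((Matrix.of (L t))⁻¹ * (Matrix.of (Q t))ᵀ))
              - (2 : ℝ) • ((Matrix.of (Q t) * (Matrix.of (L t))⁻¹) * Matrix.of (L₁ t) * (Matrix.of (L t))⁻¹ * (Matrix.of (Q₁ t))ᵀ)
              + (2 : ℝ) • (Matrix.of (Q₁ t) * (Matrix.of (L t))⁻¹ * (Matrix.of (Q₁ t))ᵀ)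
              + (2 : ℝ) • ((Matrix.of (Q t) * (Matrix.of (L t))⁻¹) * Matrix.of (L₁ t) * (Matrix.of (L t))⁻¹ * Matrix.of (L₁ t)
                  * ((Matrix.of (L t))⁻¹ * (Matrix.of (Q t))ᵀ))
              - (Matrix.of (Q t) * (Matrix.of (L t))⁻¹) * L₂ * ((Matrix.of (L t))⁻¹ * (Matrix.of (Q t))ᵀ)) := by
  -- the three curves in `LogDetSecondVariation`'s currency
  have hL' : ∀ᶠ u in 𝓝 t, HasDerivAt L (Matrix.of.symm (Matrix.of (L₁ u))) u := hL
  have hQ' : ∀ᶠ u in 𝓝 t, HasDerivAt Q (Matrix.of.symm (Matrix.of (Q₁ u))) u := hQ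
  -- (A) Bałaban's bordered curve
  have hAd : ∀ᶠ u in 𝓝 t, HasDerivAt (fun u => Matrix.of.symm (kkt (Matrix.of (L u)) (Matrix.of (Q u))))
      ((fun u => Matrix.of.symm (kkt (Matrix.of (L₁ u)) (Matrix.of (Q₁ u)))) u) u := by
    filter_upwards [hL', hQ'] with u huL huQ
    exact hasDerivAt_kkt huL huQ
  have hA₁d : HasDerivAt (fun u => Matrix.of.symm (kkt (Matrix.of (L₁ u)) (Matrix.of (Q₁ u)))) (Matrix.of.symm (kkt L₂ Q₂)) t :=
    hasDerivAt_kkt hL₁ hQ₁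
  have hdA : (Matrix.of (Matrix.of.symm (kkt (Matrix.of (L t)) (Matrix.of (Q t))))).det ≠ 0 :=
    det_kkt_ne_zero _ _ (isUnit_iff_ne_zero.2 hdetL) (isUnit_iff_ne_zero.2 hP)
  -- (C) the block-propagator curve with its explicit jets
  set C : ℝ → μ → μ → ℝ := fun u => Matrix.of.symm (blockProp (Matrix.of (L u)) (Matrix.of (Q u))) with hCdef
  set C₁ : ℝ → μ → μ → ℝ := fun u => Matrix.of.symm (Matrix.of (Q₁ u) * (Matrix.of (L u))⁻¹ * (Matrix.of (Q u))ᵀ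
      + Matrix.of (Q u) * (Matrix.of (L u))⁻¹ * (Matrix.of (Q₁ u))ᵀ
      - Matrix.of (Q u) * (Matrix.of (L u))⁻¹ * Matrix.of (L₁ u) * (Matrix.of (L u))⁻¹ * (Matrix.of (Q u))ᵀ) with hC₁def
  have hdetL' : ∀ᶠ u in 𝓝 t, (Matrix.of (L u)).det ≠ 0 := eventually_det_ne_zero hL.self_of_nhds.hasFDerivAt hdetL
  have hCd : ∀ᶠ u in 𝓝 t, HasDerivAt C (C₁ u) u := by
    filter_upwards [hL', hQ', hdetL'] with u huL huQ hud
    have h := InducedPolarizationCurve.hasDerivAt_blockProp huL huQ hud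
    rw [hCdef]
    convert h using 2
    simp only [Matrix.mul_assoc]
  have hC₁d := InducedPolarizationCurve.hasDerivAt_blockProp_jet₁ hL.self_of_nhds hQ.self_of_nhds hL₁ hQ₁ hdetL
  have hdC : (Matrix.of (C t)).det ≠ 0 := by simpa only [hCdef, Equiv.apply_symm_apply] using hP
  -- the identity `log|det 𝕂| − log|det L| − log|det P| = 0` near `t`
  have hdC' : ∀ᶠ u in 𝓝 t, (Matrix.of (C u)).det ≠ 0 := eventually_det_ne_zero hCd.self_of_nhds.hasFDerivAt hdC
  have heq : ∀ᶠ u in 𝓝 t,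
      (1 : ℝ) * Real.log |(Matrix.of (Matrix.of.symm (kkt (Matrix.of (L u)) (Matrix.of (Q u))))).det|
        + (-1) * Real.log |(Matrix.of (L u)).det| + (-1) * Real.log |(Matrix.of (C u)).det| + 0 * Real.log |(Matrix.of (L u)).det| = 0 := by
    filter_upwards [hdetL', hdC'] with u hu huC
    have huC' : (blockProp (Matrix.of (L u)) (Matrix.of (Q u))).det ≠ 0 := by simpa only [hCdef, Equiv.apply_symm_apply] using huC
    show (1 : ℝ) * Real.log |(kkt (Matrix.of (L u)) (Matrix.of (Q u))).det| + (-1) * Real.log |(Matrix.of (L u)).det|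
      + (-1) * Real.log |(blockProp (Matrix.of (L u)) (Matrix.of (Q u))).det| + 0 * Real.log |(Matrix.of (L u)).det| = 0
    rw [det_kkt' _ _ (isUnit_iff_ne_zero.2 hu), abs_mul, abs_mul, abs_neg_one_pow]
    simp only [one_mul]
    rw [Real.log_mul (abs_ne_zero.2 hu) (abs_ne_zero.2 huC')]
    ring
  have h := secondVar_comb_eq_zero (a := 1) (b := -1) (c := -1) (d := 0) (k := 0) (t := t)
    hAd hA₁d hdA hL hL₁ hdetL hCd hC₁d hdC hL hL₁ hdetL heq
  simp only [one_mul, neg_one_mul, zero_mul, add_zero] at h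
  have h' : secondVar (kkt (Matrix.of (L t)) (Matrix.of (Q t))) (kkt (Matrix.of (L₁ t)) (Matrix.of (Q₁ t))) (kkt L₂ Q₂)
      + -secondVar (Matrix.of (L t)) (Matrix.of (L₁ t)) L₂
      + -secondVar (blockProp (Matrix.of (L t)) (Matrix.of (Q t)))
            (Matrix.of (Q₁ t) * (Matrix.of (L t))⁻¹ * (Matrix.of (Q t))ᵀ + Matrix.of (Q t) * (Matrix.of (L t))⁻¹ * (Matrix.of (Q₁ t))ᵀ
                - Matrix.of (Q t) * (Matrix.of (L t))⁻¹ * Matrix.of (L₁ t) * (Matrix.of (L t))⁻¹ * (Matrix.of (Q t))ᵀ)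
            (Q₂ * ((Matrix.of (L t))⁻¹ * (Matrix.of (Q t))ᵀ) + (Matrix.of (Q t) * (Matrix.of (L t))⁻¹) * Q₂ᵀ
              - (2 : ℝ) • (Matrix.of (Q₁ t) * (Matrix.of (L t))⁻¹ * Matrix.of (L₁ t) * ((Matrix.of (L t))⁻¹ * (Matrix.of (Q t))ᵀ))
              - (2 : ℝ) • ((Matrix.of (Q t) * (Matrix.of (L t))⁻¹) * Matrix.of (L₁ t) * (Matrix.of (L t))⁻¹ * (Matrix.of (Q₁ t))ᵀ)
              + (2 : ℝ) • (Matrix.of (Q₁ t) * (Matrix.of (L t))⁻¹ * (Matrix.of (Q₁ t))ᵀ)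
              + (2 : ℝ) • ((Matrix.of (Q t) * (Matrix.of (L t))⁻¹) * Matrix.of (L₁ t) * (Matrix.of (L t))⁻¹ * Matrix.of (L₁ t)
                  * ((Matrix.of (L t))⁻¹ * (Matrix.of (Q t))ᵀ))
              - (Matrix.of (Q t) * (Matrix.of (L t))⁻¹) * L₂ * ((Matrix.of (L t))⁻¹ * (Matrix.of (Q t))ᵀ)) = 0 := h
  linarith

end Summit.QuantumFields.BalabanUV.Beta.FP.GhostPairingSplit

end
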